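import Summits.RiemannHypothesis.RiemannHypothesis.Theorems.GroundBartaEvenWinsBeyondArchDeflationCrossPanels
import Summits.RiemannHypothesis.RiemannHypothesis.Theorems.GroundBartaEvenWinsBeyondArchDeflationPanelQLoc4Four
import HarnessLib

/-!
# RiemannHypothesis / GroundBarta — rung 4 (`EvenWinsBeyondArch`, stmt-RiemannHypothesis-18807 / 18085):
# the deflated Temple L-side beyond `(log 5)/2` (four slots) — per-panel two-sided bounds on the residual cross products

Helper file (`--supports stmt-RiemannHypothesis-18807`), RH-free, no facts.  rh-explicit seat weil-5 (lead ruling R3-8a, 2026-08-22),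
four-slot twin of prover B's …DeflationCrossPanels: `dt_tmemW4_bulk`, `dt_tmemW4_bulk''`, `dt_panelCross4_bulk''`, `dt_panelCross4_split`,
`dt_panelCross4_split''` on `dt_WinL4` / `dt_windowResidual4`, and the assembly `dt_windowResidual4_mul_intervalIntegrableL`,
`dt_hcross_of_panelQL4` with the four-slot `hprimes`.  Proofs = B's.

References: E. Bombieri, Rend. Mat. Acc. Lincei (9) 11 (2000) Thm 2 [Bombieri2000Weil]; Goerisch–Haunhorst (1985) [GoerischHaunhorst1985].
-/

set_option linter.dupNamespace false

noncomputable section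

open MeasureTheory Set Filter intervalIntegral
open scoped Topology BigOperators ComplexConjugate

namespace Summit.RiemannHypothesis.RiemannHypothesis.Theorems.EvenWinsBeyondArch

open Literature.NumberTheory.LFunctions
open Literature.Analysis.ValidatedNumerics Literature.Analysis.ValidatedNumerics.PolyMP
  Literature.Analysis.ValidatedNumerics.NumericsMP Literature.Analysis.ValidatedNumerics.ExpPoly

section CrossPanels4

variable {S : ℕ} {c : ℚ} {m Dl k : ℕ}

/-- **The residual of vector `i` on bulk panel `j` is enclosed by the panel model** (the Taylor-model membership inside
`dt_panelQL_bulk`, exposed). [cite: Bombieri2000Weil, Thm 2] -/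
theorem dt_tmemW4_bulk (hS : 0 < S) (hc : 0 < c) (W : dt_WinL4 S c m Dl) (hh1 : 2 * (c / (2 * m)) ≤ 1)
    (gp : Fin k → Poly) (Mt : ℚ) (Wt : Fin k → Fin k → ℚ) (i : Fin k) (V : dt_VecL S c m Dl (gp i)) {j : ℕ}
    (hjm : j + 2 ≤ m) {K : ℕ} (hK : 0 < K) {Ke ke : ℕ} {f1 f2 f3 f4 : Bool × Bool}
    (hchk : dt_bulkCheckL4 S c m Dl W (gp i) j Ke ke f1 f2 f3 f4 = true) :
    TMem S (c / (2 * m)) (fun ρ ↦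
      dt_windowResidual4 (c : ℝ) gp W.w1 W.L1 W.w2 W.L2 W.w3 W.L3 W.w4 W.L4 (Mt : ℝ) (fun a l ↦ (Wt a l : ℝ)) i
        (((PolyMP.panelCentre (c / (2 * m)) j : ℚ) : ℝ) + ρ)) (dt_panelLTM4 S c m Dl K Ke ke W gp Mt Wt i V j f1 f2 f3 f4) := by
  unfold dt_bulkCheckL4 at hchk
  simp only [Bool.and_eq_true, decide_eq_true_eq] at hchk
  obtain ⟨⟨⟨⟨⟨⟨⟨⟨⟨⟨he1, he2⟩, hf1a⟩, hf1b⟩, hf2a⟩, hf2b⟩, hf3a⟩, hf3b⟩, hf4a⟩, hf4b⟩, hlenM⟩ := hchk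
  have hTM := dt_tmem_panelLTM4 hS hc W hh1 gp Mt Wt i V hjm hK f1 f2 f3 f4 he1 he2 hlenM
  refine tmem_congr_on hTM fun ρ hρ ↦ ?_
  rw [dt_windowResidual4_panelForm c gp W.w1 W.L1 W.w2 W.L2 W.w3 W.L3 W.w4 W.L4 Mt Wt i _ ρ,
    dt_primeSlotFn_eq_indicator (gp i) W.w1 W.L1 (dt_flagMinus_sound hS hf1a W.hL1 hρ) (dt_flagPlus_sound hS hf1b W.hL1 hρ),
    dt_primeSlotFn_eq_indicator (gp i) W.w2 W.L2 (dt_flagMinus_sound hS hf2a W.hL2 hρ) (dt_flagPlus_sound hS hf2b W.hL2 hρ),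
    dt_primeSlotFn_eq_indicator (gp i) W.w3 W.L3 (dt_flagMinus_sound hS hf3a W.hL3 hρ) (dt_flagPlus_sound hS hf3b W.hL3 hρ),
    dt_primeSlotFn_eq_indicator (gp i) W.w4 W.L4 (dt_flagMinus_sound hS hf4a W.hL4 hρ) (dt_flagPlus_sound hS hf4b W.hL4 hρ)]

/-- The same for the chunked model (arch pieces as proven-equal literals). -/
theorem dt_tmemW4_bulk'' (hS : 0 < S) (hc : 0 < c) (W : dt_WinL4 S c m Dl) (hh1 : 2 * (c / (2 * m)) ≤ 1)
    (gp : Fin k → Poly) (Mt : ℚ) (Wt : Fin k → Fin k → ℚ) (i : Fin k) (V : dt_VecL S c m Dl (gp i)) {j : ℕ}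
    (hjm : j + 2 ≤ m) {K : ℕ} (hK : 0 < K) {Ke ke : ℕ} {f1 f2 f3 f4 : Bool × Bool}
    (hchk : dt_bulkCheckL4 S c m Dl W (gp i) j Ke ke f1 f2 f3 f4 = true)
    {Etm F N R : IPoly}
    (hE : dt_archETM S c m j Dl (dt_locI S (gp i) (ofRat S (PolyMP.panelCentre (c / (2 * m)) j))) W.M0 (ttruncI S (c / (2 * m)) Dl (dt_locI S (gp i) (ofRat S (PolyMP.panelCentre (c / (2 * m)) j)))) V.tabF W.muF (fun i ↦ (W.Dρ.getD i default).1) (fun i ↦ (W.Dρ.getD i default).2) = Etm)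
    (hF : dt_archHfoldTM S m j (ttruncI S (c / (2 * m)) Dl (dt_locI S (gp i) (ofRat S (PolyMP.panelCentre (c / (2 * m)) j)))) V.tabF W.muF = F) (hN : dt_archHnearTM S c m j Dl (ttruncI S (c / (2 * m)) Dl (dt_locI S (gp i) (ofRat S (PolyMP.panelCentre (c / (2 * m)) j)))) V.tabF W.muF (fun i ↦ (W.Dρ.getD i default).1) (fun i ↦ (W.Dρ.getD i default).2) = N)
    (hR : dt_archHfarTM S c m j Dl (ttruncI S (c / (2 * m)) Dl (dt_locI S (gp i) (ofRat S (PolyMP.panelCentre (c / (2 * m)) j)))) V.tabF W.muF (fun i ↦ (W.Dρ.getD i default).1) (fun i ↦ (W.Dρ.getD i default).2) = R)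
    :
    TMem S (c / (2 * m)) (fun ρ ↦
      dt_windowResidual4 (c : ℝ) gp W.w1 W.L1 W.w2 W.L2 W.w3 W.L3 W.w4 W.L4 (Mt : ℝ) (fun a l ↦ (Wt a l : ℝ)) i
        (((PolyMP.panelCentre (c / (2 * m)) j : ℚ) : ℝ) + ρ)) (dt_panelLTM4' S c m Dl K Ke ke W gp Mt Wt i V j f1 f2 f3 f4 Etm (taddI (tsubI F N) R)) := by
  subst hE; subst hF; subst hN; subst hR
  rw [← dt_archHTM_split, dt_panelLTM4'_eq]
  exact dt_tmemW4_bulk hS hc W hh1 gp Mt Wt i V hjm hK hchk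

/-- **Cross product on a bulk panel, two-sided.**  `|∫_(-h)^h R_i R_i' − [∫ p p']| ≤ crossErrQ …`.
[cite: Bombieri2000Weil, Thm 2] [cite: GoerischHaunhorst1985, §2] -/
theorem dt_panelCross4_bulk'' (hS : 0 < S) (hc : 0 < c) (W : dt_WinL4 S c m Dl) (hh1 : 2 * (c / (2 * m)) ≤ 1)
    (gp : Fin k → Poly) (Mt : ℚ) (Wt : Fin k → Fin k → ℚ) (i i' : Fin k) (V : dt_VecL S c m Dl (gp i))
    (V' : dt_VecL S c m Dl (gp i')) {j : ℕ}
    (hjm : j + 2 ≤ m) {K : ℕ} (hK : 0 < K) {Ke ke : ℕ} {f1 f2 f3 f4 : Bool × Bool}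
    (hchk : dt_bulkCheckL4 S c m Dl W (gp i) j Ke ke f1 f2 f3 f4 = true)
    (hchk' : dt_bulkCheckL4 S c m Dl W (gp i') j Ke ke f1 f2 f3 f4 = true)
    {Etm F N R : IPoly}
    (hE : dt_archETM S c m j Dl (dt_locI S (gp i) (ofRat S (PolyMP.panelCentre (c / (2 * m)) j))) W.M0 (ttruncI S (c / (2 * m)) Dl (dt_locI S (gp i) (ofRat S (PolyMP.panelCentre (c / (2 * m)) j)))) V.tabF W.muF (fun i ↦ (W.Dρ.getD i default).1) (fun i ↦ (W.Dρ.getD i default).2) = Etm)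
    (hF : dt_archHfoldTM S m j (ttruncI S (c / (2 * m)) Dl (dt_locI S (gp i) (ofRat S (PolyMP.panelCentre (c / (2 * m)) j)))) V.tabF W.muF = F) (hN : dt_archHnearTM S c m j Dl (ttruncI S (c / (2 * m)) Dl (dt_locI S (gp i) (ofRat S (PolyMP.panelCentre (c / (2 * m)) j)))) V.tabF W.muF (fun i ↦ (W.Dρ.getD i default).1) (fun i ↦ (W.Dρ.getD i default).2) = N)
    (hR : dt_archHfarTM S c m j Dl (ttruncI S (c / (2 * m)) Dl (dt_locI S (gp i) (ofRat S (PolyMP.panelCentre (c / (2 * m)) j)))) V.tabF W.muF (fun i ↦ (W.Dρ.getD i default).1) (fun i ↦ (W.Dρ.getD i default).2) = R)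
    {Etm' F' N' R' : IPoly}
    (hE' : dt_archETM S c m j Dl (dt_locI S (gp i') (ofRat S (PolyMP.panelCentre (c / (2 * m)) j))) W.M0 (ttruncI S (c / (2 * m)) Dl (dt_locI S (gp i') (ofRat S (PolyMP.panelCentre (c / (2 * m)) j)))) V'.tabF W.muF (fun i ↦ (W.Dρ.getD i default).1) (fun i ↦ (W.Dρ.getD i default).2) = Etm')
    (hF' : dt_archHfoldTM S m j (ttruncI S (c / (2 * m)) Dl (dt_locI S (gp i') (ofRat S (PolyMP.panelCentre (c / (2 * m)) j)))) V'.tabF W.muF = F') (hN' : dt_archHnearTM S c m j Dl (ttruncI S (c / (2 * m)) Dl (dt_locI S (gp i') (ofRat S (PolyMP.panelCentre (c / (2 * m)) j)))) V'.tabF W.muF (fun i ↦ (W.Dρ.getD i default).1) (fun i ↦ (W.Dρ.getD i default).2) = N')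
    (hR' : dt_archHfarTM S c m j Dl (ttruncI S (c / (2 * m)) Dl (dt_locI S (gp i') (ofRat S (PolyMP.panelCentre (c / (2 * m)) j)))) V'.tabF W.muF (fun i ↦ (W.Dρ.getD i default).1) (fun i ↦ (W.Dρ.getD i default).2) = R')
    (hfg : IntervalIntegrable (fun ρ ↦
      dt_windowResidual4 (c : ℝ) gp W.w1 W.L1 W.w2 W.L2 W.w3 W.L3 W.w4 W.L4 (Mt : ℝ) (fun a l ↦ (Wt a l : ℝ)) i
        (((PolyMP.panelCentre (c / (2 * m)) j : ℚ) : ℝ) + ρ) *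
      dt_windowResidual4 (c : ℝ) gp W.w1 W.L1 W.w2 W.L2 W.w3 W.L3 W.w4 W.L4 (Mt : ℝ) (fun a l ↦ (Wt a l : ℝ)) i'
        (((PolyMP.panelCentre (c / (2 * m)) j : ℚ) : ℝ) + ρ)) volume (-((c / (2 * m) : ℚ) : ℝ)) ((c / (2 * m) : ℚ) : ℝ))
    (p p' : Poly) :
    |(∫ ρ in (-((c / (2 * m) : ℚ) : ℝ))..((c / (2 * m) : ℚ) : ℝ),
        dt_windowResidual4 (c : ℝ) gp W.w1 W.L1 W.w2 W.L2 W.w3 W.L3 W.w4 W.L4 (Mt : ℝ) (fun a l ↦ (Wt a l : ℝ)) i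
        (((PolyMP.panelCentre (c / (2 * m)) j : ℚ) : ℝ) + ρ) *
        dt_windowResidual4 (c : ℝ) gp W.w1 W.L1 W.w2 W.L2 W.w3 W.L3 W.w4 W.L4 (Mt : ℝ) (fun a l ↦ (Wt a l : ℝ)) i'
        (((PolyMP.panelCentre (c / (2 * m)) j : ℚ) : ℝ) + ρ)) -
        ((crossCentreQ p p' (-(c / (2 * m))) (c / (2 * m)) : ℚ) : ℝ)| ≤
      ((crossErrQ S (c / (2 * m)) (dt_panelLTM4' S c m Dl K Ke ke W gp Mt Wt i V j f1 f2 f3 f4 Etm (taddI (tsubI F N) R)) p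
          (dt_panelLTM4' S c m Dl K Ke ke W gp Mt Wt i' V' j f1 f2 f3 f4 Etm' (taddI (tsubI F' N') R')) p' (-(c / (2 * m))) (c / (2 * m)) 0 : ℚ) : ℝ) := by
  have hm : 0 < m := by omega
  have hh0 : 0 ≤ c / (2 * m) := by
    have : (0 : ℚ) < m := by exact_mod_cast hm
    positivity
  have hA := dt_tmemW4_bulk'' hS hc W hh1 gp Mt Wt i V hjm hK hchk hE hF hN hR
  have hB := dt_tmemW4_bulk'' hS hc W hh1 gp Mt Wt i' V' hjm hK hchk' hE' hF' hN' hR'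
  have := integral_mul_abs_le hS hh0 hA hB p p' (by simpa using hfg)
  simpa using this

/-- **Cross product on a split panel, two-sided** (breakpoint `β ∈ [b⁻, b⁺]`, flags `f` on `(-h, β)` and `f'` on `(β, h)`,
shared by both vectors; unchunked models). [cite: Bombieri2000Weil, Thm 2] [cite: GoerischHaunhorst1985, §2] -/
theorem dt_panelCross4_split (hS : 0 < S) (hc : 0 < c) (W : dt_WinL4 S c m Dl) (hh1 : 2 * (c / (2 * m)) ≤ 1)
    (gp : Fin k → Poly) (Mt : ℚ) (Wt : Fin k → Fin k → ℚ) (i i' : Fin k) (V : dt_VecL S c m Dl (gp i))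
    (V' : dt_VecL S c m Dl (gp i')) {j : ℕ}
    (hjm : j + 2 ≤ m) {K : ℕ} (hK : 0 < K) {Ke ke : ℕ} (f1 f2 f3 f4 f1' f2' f3' f4' : Bool × Bool) {β : ℝ} {bm bp : ℚ}
    (hchk : dt_splitCheckL S c m W.M0.length (gp i) j Ke ke bm bp = true)
    (hchk' : dt_splitCheckL S c m W.M0.length (gp i') j Ke ke bm bp = true) (hbmβ : (bm : ℝ) ≤ β) (hβbp : β ≤ bp)
    (hflA : ∀ ρ : ℝ, -((c / (2 * m) : ℚ) : ℝ) < ρ → ρ < β →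
      (f1.1 = true ↔ (((PolyMP.panelCentre (c / (2 * m)) j : ℚ) : ℝ) + ρ) - W.L1 ∈ Icc (-(c : ℝ)) c) ∧
      (f1.2 = true ↔ (((PolyMP.panelCentre (c / (2 * m)) j : ℚ) : ℝ) + ρ) + W.L1 ∈ Icc (-(c : ℝ)) c) ∧
      (f2.1 = true ↔ (((PolyMP.panelCentre (c / (2 * m)) j : ℚ) : ℝ) + ρ) - W.L2 ∈ Icc (-(c : ℝ)) c) ∧
      (f2.2 = true ↔ (((PolyMP.panelCentre (c / (2 * m)) j : ℚ) : ℝ) + ρ) + W.L2 ∈ Icc (-(c : ℝ)) c) ∧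
      (f3.1 = true ↔ (((PolyMP.panelCentre (c / (2 * m)) j : ℚ) : ℝ) + ρ) - W.L3 ∈ Icc (-(c : ℝ)) c) ∧
      (f3.2 = true ↔ (((PolyMP.panelCentre (c / (2 * m)) j : ℚ) : ℝ) + ρ) + W.L3 ∈ Icc (-(c : ℝ)) c) ∧
      (f4.1 = true ↔ (((PolyMP.panelCentre (c / (2 * m)) j : ℚ) : ℝ) + ρ) - W.L4 ∈ Icc (-(c : ℝ)) c) ∧
      (f4.2 = true ↔ (((PolyMP.panelCentre (c / (2 * m)) j : ℚ) : ℝ) + ρ) + W.L4 ∈ Icc (-(c : ℝ)) c))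
    (hflB : ∀ ρ : ℝ, β < ρ → ρ < ((c / (2 * m) : ℚ) : ℝ) →
      (f1'.1 = true ↔ (((PolyMP.panelCentre (c / (2 * m)) j : ℚ) : ℝ) + ρ) - W.L1 ∈ Icc (-(c : ℝ)) c) ∧
      (f1'.2 = true ↔ (((PolyMP.panelCentre (c / (2 * m)) j : ℚ) : ℝ) + ρ) + W.L1 ∈ Icc (-(c : ℝ)) c) ∧
      (f2'.1 = true ↔ (((PolyMP.panelCentre (c / (2 * m)) j : ℚ) : ℝ) + ρ) - W.L2 ∈ Icc (-(c : ℝ)) c) ∧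
      (f2'.2 = true ↔ (((PolyMP.panelCentre (c / (2 * m)) j : ℚ) : ℝ) + ρ) + W.L2 ∈ Icc (-(c : ℝ)) c) ∧
      (f3'.1 = true ↔ (((PolyMP.panelCentre (c / (2 * m)) j : ℚ) : ℝ) + ρ) - W.L3 ∈ Icc (-(c : ℝ)) c) ∧
      (f3'.2 = true ↔ (((PolyMP.panelCentre (c / (2 * m)) j : ℚ) : ℝ) + ρ) + W.L3 ∈ Icc (-(c : ℝ)) c) ∧
      (f4'.1 = true ↔ (((PolyMP.panelCentre (c / (2 * m)) j : ℚ) : ℝ) + ρ) - W.L4 ∈ Icc (-(c : ℝ)) c) ∧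
      (f4'.2 = true ↔ (((PolyMP.panelCentre (c / (2 * m)) j : ℚ) : ℝ) + ρ) + W.L4 ∈ Icc (-(c : ℝ)) c))
    (hfg : IntervalIntegrable (fun ρ ↦
      dt_windowResidual4 (c : ℝ) gp W.w1 W.L1 W.w2 W.L2 W.w3 W.L3 W.w4 W.L4 (Mt : ℝ) (fun a l ↦ (Wt a l : ℝ)) i
        (((PolyMP.panelCentre (c / (2 * m)) j : ℚ) : ℝ) + ρ) *
      dt_windowResidual4 (c : ℝ) gp W.w1 W.L1 W.w2 W.L2 W.w3 W.L3 W.w4 W.L4 (Mt : ℝ) (fun a l ↦ (Wt a l : ℝ)) i'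
        (((PolyMP.panelCentre (c / (2 * m)) j : ℚ) : ℝ) + ρ)) volume (-((c / (2 * m) : ℚ) : ℝ)) ((c / (2 * m) : ℚ) : ℝ))
    (pA pA' pB pB' : Poly) :
    |(∫ ρ in (-((c / (2 * m) : ℚ) : ℝ))..((c / (2 * m) : ℚ) : ℝ),
        dt_windowResidual4 (c : ℝ) gp W.w1 W.L1 W.w2 W.L2 W.w3 W.L3 W.w4 W.L4 (Mt : ℝ) (fun a l ↦ (Wt a l : ℝ)) i
        (((PolyMP.panelCentre (c / (2 * m)) j : ℚ) : ℝ) + ρ) *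
        dt_windowResidual4 (c : ℝ) gp W.w1 W.L1 W.w2 W.L2 W.w3 W.L3 W.w4 W.L4 (Mt : ℝ) (fun a l ↦ (Wt a l : ℝ)) i'
        (((PolyMP.panelCentre (c / (2 * m)) j : ℚ) : ℝ) + ρ)) -
        (((crossCentreQ pA pA' (-(c / (2 * m))) bp : ℚ) : ℝ) + ((crossCentreQ pB pB' bm (c / (2 * m)) : ℚ) : ℝ))| ≤
      ((crossErrQ S (c / (2 * m)) (dt_panelLTM4 S c m Dl K Ke ke W gp Mt Wt i V j f1 f2 f3 f4) pA (dt_panelLTM4 S c m Dl K Ke ke W gp Mt Wt i' V' j f1 f2 f3 f4) pA'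
          (-(c / (2 * m))) bp (bp - bm) : ℚ) : ℝ) +
        ((crossErrQ S (c / (2 * m)) (dt_panelLTM4 S c m Dl K Ke ke W gp Mt Wt i V j f1' f2' f3' f4') pB (dt_panelLTM4 S c m Dl K Ke ke W gp Mt Wt i' V' j f1' f2' f3' f4') pB'
          bm (c / (2 * m)) (bp - bm) : ℚ) : ℝ) := by
  unfold dt_splitCheckL at hchk hchk'
  simp only [Bool.and_eq_true, decide_eq_true_eq] at hchk hchk'
  obtain ⟨⟨⟨⟨he1, he2⟩, hbm⟩, hbp⟩, hlenM⟩ := hchk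
  obtain ⟨⟨⟨⟨_, _⟩, _⟩, _⟩, hlenM'⟩ := hchk'
  have hm : 0 < m := by omega
  have hh0 : 0 ≤ c / (2 * m) := by
    have : (0 : ℚ) < m := by exact_mod_cast hm
    positivity
  have hA := dt_tmem_panelLTM4 hS hc W hh1 gp Mt Wt i V hjm hK f1 f2 f3 f4 he1 he2 hlenM
  have hB := dt_tmem_panelLTM4 hS hc W hh1 gp Mt Wt i V hjm hK f1' f2' f3' f4' he1 he2 hlenM
  have hA' := dt_tmem_panelLTM4 hS hc W hh1 gp Mt Wt i' V' hjm hK f1 f2 f3 f4 he1 he2 hlenM'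
  have hB' := dt_tmem_panelLTM4 hS hc W hh1 gp Mt Wt i' V' hjm hK f1' f2' f3' f4' he1 he2 hlenM'
  have key := integral_mul_split_abs_le hS hh0 hA hA' hB hB' pA pA' pB pB' hbm hbmβ hβbp hbp
    (fun ρ hρ ↦ ?_) (fun ρ hρ ↦ ?_) (fun ρ hρ ↦ ?_) (fun ρ hρ ↦ ?_) (by simpa using hfg)
  · simpa using key
  · obtain ⟨h1a, h1b, h2a, h2b, h3a, h3b, h4a, h4b⟩ := hflA ρ hρ.1 hρ.2
    simp only [dt_windowResidual4_panelForm c gp W.w1 W.L1 W.w2 W.L2 W.w3 W.L3 W.w4 W.L4 Mt Wt i _ ρ,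
      dt_primeSlotFn_eq_indicator (gp i) W.w1 W.L1 h1a h1b, dt_primeSlotFn_eq_indicator (gp i) W.w2 W.L2 h2a h2b,
      dt_primeSlotFn_eq_indicator (gp i) W.w3 W.L3 h3a h3b, dt_primeSlotFn_eq_indicator (gp i) W.w4 W.L4 h4a h4b]
  · obtain ⟨h1a, h1b, h2a, h2b, h3a, h3b, h4a, h4b⟩ := hflA ρ hρ.1 hρ.2
    simp only [dt_windowResidual4_panelForm c gp W.w1 W.L1 W.w2 W.L2 W.w3 W.L3 W.w4 W.L4 Mt Wt i' _ ρ,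
      dt_primeSlotFn_eq_indicator (gp i') W.w1 W.L1 h1a h1b, dt_primeSlotFn_eq_indicator (gp i') W.w2 W.L2 h2a h2b,
      dt_primeSlotFn_eq_indicator (gp i') W.w3 W.L3 h3a h3b, dt_primeSlotFn_eq_indicator (gp i') W.w4 W.L4 h4a h4b]
  · obtain ⟨h1a, h1b, h2a, h2b, h3a, h3b, h4a, h4b⟩ := hflB ρ hρ.1 hρ.2
    simp only [dt_windowResidual4_panelForm c gp W.w1 W.L1 W.w2 W.L2 W.w3 W.L3 W.w4 W.L4 Mt Wt i _ ρ,
      dt_primeSlotFn_eq_indicator (gp i) W.w1 W.L1 h1a h1b, dt_primeSlotFn_eq_indicator (gp i) W.w2 W.L2 h2a h2b,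
      dt_primeSlotFn_eq_indicator (gp i) W.w3 W.L3 h3a h3b, dt_primeSlotFn_eq_indicator (gp i) W.w4 W.L4 h4a h4b]
  · obtain ⟨h1a, h1b, h2a, h2b, h3a, h3b, h4a, h4b⟩ := hflB ρ hρ.1 hρ.2
    simp only [dt_windowResidual4_panelForm c gp W.w1 W.L1 W.w2 W.L2 W.w3 W.L3 W.w4 W.L4 Mt Wt i' _ ρ,
      dt_primeSlotFn_eq_indicator (gp i') W.w1 W.L1 h1a h1b, dt_primeSlotFn_eq_indicator (gp i') W.w2 W.L2 h2a h2b,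
      dt_primeSlotFn_eq_indicator (gp i') W.w3 W.L3 h3a h3b, dt_primeSlotFn_eq_indicator (gp i') W.w4 W.L4 h4a h4b]

/-- The same with the chunked models (arch pieces of both vectors as proven-equal literals). -/
theorem dt_panelCross4_split'' (hS : 0 < S) (hc : 0 < c) (W : dt_WinL4 S c m Dl) (hh1 : 2 * (c / (2 * m)) ≤ 1)
    (gp : Fin k → Poly) (Mt : ℚ) (Wt : Fin k → Fin k → ℚ) (i i' : Fin k) (V : dt_VecL S c m Dl (gp i))
    (V' : dt_VecL S c m Dl (gp i')) {j : ℕ}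
    (hjm : j + 2 ≤ m) {K : ℕ} (hK : 0 < K) {Ke ke : ℕ} (f1 f2 f3 f4 f1' f2' f3' f4' : Bool × Bool) {β : ℝ} {bm bp : ℚ}
    (hchk : dt_splitCheckL S c m W.M0.length (gp i) j Ke ke bm bp = true)
    (hchk' : dt_splitCheckL S c m W.M0.length (gp i') j Ke ke bm bp = true) (hbmβ : (bm : ℝ) ≤ β) (hβbp : β ≤ bp)
    (hflA : ∀ ρ : ℝ, -((c / (2 * m) : ℚ) : ℝ) < ρ → ρ < β →
      (f1.1 = true ↔ (((PolyMP.panelCentre (c / (2 * m)) j : ℚ) : ℝ) + ρ) - W.L1 ∈ Icc (-(c : ℝ)) c) ∧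
      (f1.2 = true ↔ (((PolyMP.panelCentre (c / (2 * m)) j : ℚ) : ℝ) + ρ) + W.L1 ∈ Icc (-(c : ℝ)) c) ∧
      (f2.1 = true ↔ (((PolyMP.panelCentre (c / (2 * m)) j : ℚ) : ℝ) + ρ) - W.L2 ∈ Icc (-(c : ℝ)) c) ∧
      (f2.2 = true ↔ (((PolyMP.panelCentre (c / (2 * m)) j : ℚ) : ℝ) + ρ) + W.L2 ∈ Icc (-(c : ℝ)) c) ∧
      (f3.1 = true ↔ (((PolyMP.panelCentre (c / (2 * m)) j : ℚ) : ℝ) + ρ) - W.L3 ∈ Icc (-(c : ℝ)) c) ∧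
      (f3.2 = true ↔ (((PolyMP.panelCentre (c / (2 * m)) j : ℚ) : ℝ) + ρ) + W.L3 ∈ Icc (-(c : ℝ)) c) ∧
      (f4.1 = true ↔ (((PolyMP.panelCentre (c / (2 * m)) j : ℚ) : ℝ) + ρ) - W.L4 ∈ Icc (-(c : ℝ)) c) ∧
      (f4.2 = true ↔ (((PolyMP.panelCentre (c / (2 * m)) j : ℚ) : ℝ) + ρ) + W.L4 ∈ Icc (-(c : ℝ)) c))
    (hflB : ∀ ρ : ℝ, β < ρ → ρ < ((c / (2 * m) : ℚ) : ℝ) →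
      (f1'.1 = true ↔ (((PolyMP.panelCentre (c / (2 * m)) j : ℚ) : ℝ) + ρ) - W.L1 ∈ Icc (-(c : ℝ)) c) ∧
      (f1'.2 = true ↔ (((PolyMP.panelCentre (c / (2 * m)) j : ℚ) : ℝ) + ρ) + W.L1 ∈ Icc (-(c : ℝ)) c) ∧
      (f2'.1 = true ↔ (((PolyMP.panelCentre (c / (2 * m)) j : ℚ) : ℝ) + ρ) - W.L2 ∈ Icc (-(c : ℝ)) c) ∧
      (f2'.2 = true ↔ (((PolyMP.panelCentre (c / (2 * m)) j : ℚ) : ℝ) + ρ) + W.L2 ∈ Icc (-(c : ℝ)) c) ∧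
      (f3'.1 = true ↔ (((PolyMP.panelCentre (c / (2 * m)) j : ℚ) : ℝ) + ρ) - W.L3 ∈ Icc (-(c : ℝ)) c) ∧
      (f3'.2 = true ↔ (((PolyMP.panelCentre (c / (2 * m)) j : ℚ) : ℝ) + ρ) + W.L3 ∈ Icc (-(c : ℝ)) c) ∧
      (f4'.1 = true ↔ (((PolyMP.panelCentre (c / (2 * m)) j : ℚ) : ℝ) + ρ) - W.L4 ∈ Icc (-(c : ℝ)) c) ∧
      (f4'.2 = true ↔ (((PolyMP.panelCentre (c / (2 * m)) j : ℚ) : ℝ) + ρ) + W.L4 ∈ Icc (-(c : ℝ)) c))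
    {Etm F N R : IPoly}
    (hE : dt_archETM S c m j Dl (dt_locI S (gp i) (ofRat S (PolyMP.panelCentre (c / (2 * m)) j))) W.M0 (ttruncI S (c / (2 * m)) Dl (dt_locI S (gp i) (ofRat S (PolyMP.panelCentre (c / (2 * m)) j)))) V.tabF W.muF (fun i ↦ (W.Dρ.getD i default).1) (fun i ↦ (W.Dρ.getD i default).2) = Etm)
    (hF : dt_archHfoldTM S m j (ttruncI S (c / (2 * m)) Dl (dt_locI S (gp i) (ofRat S (PolyMP.panelCentre (c / (2 * m)) j)))) V.tabF W.muF = F) (hN : dt_archHnearTM S c m j Dl (ttruncI S (c / (2 * m)) Dl (dt_locI S (gp i) (ofRat S (PolyMP.panelCentre (c / (2 * m)) j)))) V.tabF W.muF (fun i ↦ (W.Dρ.getD i default).1) (fun i ↦ (W.Dρ.getD i default).2) = N)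
    (hR : dt_archHfarTM S c m j Dl (ttruncI S (c / (2 * m)) Dl (dt_locI S (gp i) (ofRat S (PolyMP.panelCentre (c / (2 * m)) j)))) V.tabF W.muF (fun i ↦ (W.Dρ.getD i default).1) (fun i ↦ (W.Dρ.getD i default).2) = R)
    {Etm' F' N' R' : IPoly}
    (hE' : dt_archETM S c m j Dl (dt_locI S (gp i') (ofRat S (PolyMP.panelCentre (c / (2 * m)) j))) W.M0 (ttruncI S (c / (2 * m)) Dl (dt_locI S (gp i') (ofRat S (PolyMP.panelCentre (c / (2 * m)) j)))) V'.tabF W.muF (fun i ↦ (W.Dρ.getD i default).1) (fun i ↦ (W.Dρ.getD i default).2) = Etm')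
    (hF' : dt_archHfoldTM S m j (ttruncI S (c / (2 * m)) Dl (dt_locI S (gp i') (ofRat S (PolyMP.panelCentre (c / (2 * m)) j)))) V'.tabF W.muF = F') (hN' : dt_archHnearTM S c m j Dl (ttruncI S (c / (2 * m)) Dl (dt_locI S (gp i') (ofRat S (PolyMP.panelCentre (c / (2 * m)) j)))) V'.tabF W.muF (fun i ↦ (W.Dρ.getD i default).1) (fun i ↦ (W.Dρ.getD i default).2) = N')
    (hR' : dt_archHfarTM S c m j Dl (ttruncI S (c / (2 * m)) Dl (dt_locI S (gp i') (ofRat S (PolyMP.panelCentre (c / (2 * m)) j)))) V'.tabF W.muF (fun i ↦ (W.Dρ.getD i default).1) (fun i ↦ (W.Dρ.getD i default).2) = R')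
    (hfg : IntervalIntegrable (fun ρ ↦
      dt_windowResidual4 (c : ℝ) gp W.w1 W.L1 W.w2 W.L2 W.w3 W.L3 W.w4 W.L4 (Mt : ℝ) (fun a l ↦ (Wt a l : ℝ)) i
        (((PolyMP.panelCentre (c / (2 * m)) j : ℚ) : ℝ) + ρ) *
      dt_windowResidual4 (c : ℝ) gp W.w1 W.L1 W.w2 W.L2 W.w3 W.L3 W.w4 W.L4 (Mt : ℝ) (fun a l ↦ (Wt a l : ℝ)) i'
        (((PolyMP.panelCentre (c / (2 * m)) j : ℚ) : ℝ) + ρ)) volume (-((c / (2 * m) : ℚ) : ℝ)) ((c / (2 * m) : ℚ) : ℝ))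
    (pA pA' pB pB' : Poly) :
    |(∫ ρ in (-((c / (2 * m) : ℚ) : ℝ))..((c / (2 * m) : ℚ) : ℝ),
        dt_windowResidual4 (c : ℝ) gp W.w1 W.L1 W.w2 W.L2 W.w3 W.L3 W.w4 W.L4 (Mt : ℝ) (fun a l ↦ (Wt a l : ℝ)) i
        (((PolyMP.panelCentre (c / (2 * m)) j : ℚ) : ℝ) + ρ) *
        dt_windowResidual4 (c : ℝ) gp W.w1 W.L1 W.w2 W.L2 W.w3 W.L3 W.w4 W.L4 (Mt : ℝ) (fun a l ↦ (Wt a l : ℝ)) i'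
        (((PolyMP.panelCentre (c / (2 * m)) j : ℚ) : ℝ) + ρ)) -
        (((crossCentreQ pA pA' (-(c / (2 * m))) bp : ℚ) : ℝ) + ((crossCentreQ pB pB' bm (c / (2 * m)) : ℚ) : ℝ))| ≤
      ((crossErrQ S (c / (2 * m)) (dt_panelLTM4' S c m Dl K Ke ke W gp Mt Wt i V j f1 f2 f3 f4 Etm (taddI (tsubI F N) R)) pA (dt_panelLTM4' S c m Dl K Ke ke W gp Mt Wt i' V' j f1 f2 f3 f4 Etm' (taddI (tsubI F' N') R')) pA'
          (-(c / (2 * m))) bp (bp - bm) : ℚ) : ℝ) +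
        ((crossErrQ S (c / (2 * m)) (dt_panelLTM4' S c m Dl K Ke ke W gp Mt Wt i V j f1' f2' f3' f4' Etm (taddI (tsubI F N) R)) pB (dt_panelLTM4' S c m Dl K Ke ke W gp Mt Wt i' V' j f1' f2' f3' f4' Etm' (taddI (tsubI F' N') R')) pB'
          bm (c / (2 * m)) (bp - bm) : ℚ) : ℝ) := by
  subst hE; subst hF; subst hN; subst hR; subst hE'; subst hF'; subst hN'; subst hR'
  rw [← dt_archHTM_split, ← dt_archHTM_split, dt_panelLTM4'_eq, dt_panelLTM4'_eq, dt_panelLTM4'_eq, dt_panelLTM4'_eq]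
  exact dt_panelCross4_split hS hc W hh1 gp Mt Wt i i' V V' hjm hK f1 f2 f3 f4 f1' f2' f3' f4' hchk hchk' hbmβ hβbp hflA hflB hfg
    pA pA' pB pB'

end CrossPanels4

section CrossAssembly4

variable {c : ℚ} {k : ℕ} {gp : Fin k → Poly} {v F : Fin k → ℝ → ℂ}

/-- Integrability of `R_i R_i'` on every panel (side condition of the cross bounds). -/
theorem dt_windowResidual4_mul_intervalIntegrableL (hc : 0 < c)
    (hv : ∀ i x, v i x = (((Icc (-(c : ℝ)) c).indicator (fun x ↦ Poly.eval (gp i) x) x : ℝ) : ℂ))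
    (hF : ∀ i y, F i y = (Icc (-(c : ℝ)) c).indicator (fun y ↦
        2 * (∫ x, v i x * (Real.cosh (x / 2) : ℂ)) * (Real.cosh (y / 2) : ℂ) -
          2 * (∫ x, v i x * (Real.sinh (x / 2) : ℂ)) * (Real.sinh (y / 2) : ℂ) +
        (∑ n ∈ weilPrimeIndex (c : ℝ), (((ArithmeticFunction.vonMangoldt n : ℝ) / Real.sqrt n : ℝ) : ℂ) *
          (2 * v i y - v i (y - Real.log n) - v i (y + Real.log n))) +
        ∫ t in Ioi 0, (weilArchDensity t : ℂ) * (2 * v i y - v i (y - t) - v i (y + t))) y -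
      (weilMarkovConstant (c : ℝ) : ℂ) * v i y)
    {w1 L1 w2 L2 w3 L3 w4 L4 : ℝ} (Mt : ℚ) (Wt : Fin k → Fin k → ℚ) (i i' : Fin k)
    (hprimes : ∀ y : ℝ, ∑ n ∈ weilPrimeIndex (c : ℝ), ((ArithmeticFunction.vonMangoldt n : ℝ) / Real.sqrt n) *
        (2 * Poly.eval (gp i) y - (Icc (-(c : ℝ)) c).indicator (fun x ↦ Poly.eval (gp i) x) (y - Real.log n) -
          (Icc (-(c : ℝ)) c).indicator (fun x ↦ Poly.eval (gp i) x) (y + Real.log n)) =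
      w1 * (2 * Poly.eval (gp i) y - (Icc (-(c : ℝ)) c).indicator (fun x ↦ Poly.eval (gp i) x) (y - L1) -
          (Icc (-(c : ℝ)) c).indicator (fun x ↦ Poly.eval (gp i) x) (y + L1)) +
        w2 * (2 * Poly.eval (gp i) y - (Icc (-(c : ℝ)) c).indicator (fun x ↦ Poly.eval (gp i) x) (y - L2) -
          (Icc (-(c : ℝ)) c).indicator (fun x ↦ Poly.eval (gp i) x) (y + L2)) +
        w3 * (2 * Poly.eval (gp i) y - (Icc (-(c : ℝ)) c).indicator (fun x ↦ Poly.eval (gp i) x) (y - L3) -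
          (Icc (-(c : ℝ)) c).indicator (fun x ↦ Poly.eval (gp i) x) (y + L3)) +
        w4 * (2 * Poly.eval (gp i) y - (Icc (-(c : ℝ)) c).indicator (fun x ↦ Poly.eval (gp i) x) (y - L4) -
          (Icc (-(c : ℝ)) c).indicator (fun x ↦ Poly.eval (gp i) x) (y + L4)))
    (hprimes' : ∀ y : ℝ, ∑ n ∈ weilPrimeIndex (c : ℝ), ((ArithmeticFunction.vonMangoldt n : ℝ) / Real.sqrt n) *
        (2 * Poly.eval (gp i') y - (Icc (-(c : ℝ)) c).indicator (fun x ↦ Poly.eval (gp i') x) (y - Real.log n) -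
          (Icc (-(c : ℝ)) c).indicator (fun x ↦ Poly.eval (gp i') x) (y + Real.log n)) =
      w1 * (2 * Poly.eval (gp i') y - (Icc (-(c : ℝ)) c).indicator (fun x ↦ Poly.eval (gp i') x) (y - L1) -
          (Icc (-(c : ℝ)) c).indicator (fun x ↦ Poly.eval (gp i') x) (y + L1)) +
        w2 * (2 * Poly.eval (gp i') y - (Icc (-(c : ℝ)) c).indicator (fun x ↦ Poly.eval (gp i') x) (y - L2) -
          (Icc (-(c : ℝ)) c).indicator (fun x ↦ Poly.eval (gp i') x) (y + L2)) +
        w3 * (2 * Poly.eval (gp i') y - (Icc (-(c : ℝ)) c).indicator (fun x ↦ Poly.eval (gp i') x) (y - L3) -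
          (Icc (-(c : ℝ)) c).indicator (fun x ↦ Poly.eval (gp i') x) (y + L3)) +
        w4 * (2 * Poly.eval (gp i') y - (Icc (-(c : ℝ)) c).indicator (fun x ↦ Poly.eval (gp i') x) (y - L4) -
          (Icc (-(c : ℝ)) c).indicator (fun x ↦ Poly.eval (gp i') x) (y + L4)))
    {m : ℕ} (hm : 0 < m) {j : ℕ} (hjm : j < m) :
    IntervalIntegrable (fun ρ ↦
      dt_windowResidual4 (c : ℝ) gp w1 L1 w2 L2 w3 L3 w4 L4 (Mt : ℝ) (fun a l ↦ (Wt a l : ℝ)) i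
        (((PolyMP.panelCentre (c / (2 * m)) j : ℚ) : ℝ) + ρ) *
      dt_windowResidual4 (c : ℝ) gp w1 L1 w2 L2 w3 L3 w4 L4 (Mt : ℝ) (fun a l ↦ (Wt a l : ℝ)) i'
        (((PolyMP.panelCentre (c / (2 * m)) j : ℚ) : ℝ) + ρ)) volume (-((c / (2 * m) : ℚ) : ℝ)) ((c / (2 * m) : ℚ) : ℝ) := by
  have hc' : (0 : ℝ) < c := by exact_mod_cast hc
  have e1 : (2 * (j : ℝ) + 1) * ((c : ℝ) / (2 * m)) = ((PolyMP.panelCentre (c / (2 * m)) j : ℚ) : ℝ) :=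
    (dt_panelCentre_castL c m j).symm
  have e2 : (c : ℝ) / (2 * m) = ((c / (2 * m) : ℚ) : ℝ) := (dt_halfWidth_cast c m).symm
  have h := dt_residual_mul_intervalIntegrable hc' (fun l x ↦ Poly.eval (gp l) x) (fun l ↦ dt_contDiff_polyEval (gp l)) v F hv hF
    (fun i l ↦ (Wt i l : ℝ) + if l = i then (Mt : ℝ) - weilMarkovConstant (c : ℝ) else 0) i i' hm _ _
    (fun _ hy ↦ dt_residual_eq_windowResidual4 hc' hv hF (Mt : ℝ) (fun a l ↦ (Wt a l : ℝ)) i hprimes hy)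
    (fun _ hy ↦ dt_residual_eq_windowResidual4 hc' hv hF (Mt : ℝ) (fun a l ↦ (Wt a l : ℝ)) i' hprimes' hy) hjm
  rw [e1, e2] at h
  exact h

/-- **Cross term of the residual Gram matrix from per-panel two-sided bounds**: with `W_il = W̃_il + [l = i](M̃ − M_c)`,
`r_i = F_i − Σ_l W_il v_l`, if `lo_j ≤ ∫_(-h)^h R_i R_i' ≤ hi_j` on every y-panel (given the integrability premises), then
`2 Σ lo_j ≤ (∫ r_i r̄_i').re ≤ 2 Σ hi_j`. [cite: GoerischHaunhorst1985, §2] [cite: Bombieri2000Weil, Thm 2] -/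
theorem dt_hcross_of_panelQL4 (hc : 0 < c) {σ : ℝ} (hσ : σ = 1 ∨ σ = -1)
    (hgp : ∀ i x, Poly.eval (gp i) (-x) = σ * Poly.eval (gp i) x)
    (hv : ∀ i x, v i x = (((Icc (-(c : ℝ)) c).indicator (fun x ↦ Poly.eval (gp i) x) x : ℝ) : ℂ))
    (hF : ∀ i y, F i y = (Icc (-(c : ℝ)) c).indicator (fun y ↦
        2 * (∫ x, v i x * (Real.cosh (x / 2) : ℂ)) * (Real.cosh (y / 2) : ℂ) -
          2 * (∫ x, v i x * (Real.sinh (x / 2) : ℂ)) * (Real.sinh (y / 2) : ℂ) +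
        (∑ n ∈ weilPrimeIndex (c : ℝ), (((ArithmeticFunction.vonMangoldt n : ℝ) / Real.sqrt n : ℝ) : ℂ) *
          (2 * v i y - v i (y - Real.log n) - v i (y + Real.log n))) +
        ∫ t in Ioi 0, (weilArchDensity t : ℂ) * (2 * v i y - v i (y - t) - v i (y + t))) y -
      (weilMarkovConstant (c : ℝ) : ℂ) * v i y)
    {w1 L1 w2 L2 w3 L3 w4 L4 : ℝ} (Mt : ℚ) (Wt : Fin k → Fin k → ℚ) (i i' : Fin k)
    (hprimes : ∀ y : ℝ, ∑ n ∈ weilPrimeIndex (c : ℝ), ((ArithmeticFunction.vonMangoldt n : ℝ) / Real.sqrt n) *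
        (2 * Poly.eval (gp i) y - (Icc (-(c : ℝ)) c).indicator (fun x ↦ Poly.eval (gp i) x) (y - Real.log n) -
          (Icc (-(c : ℝ)) c).indicator (fun x ↦ Poly.eval (gp i) x) (y + Real.log n)) =
      w1 * (2 * Poly.eval (gp i) y - (Icc (-(c : ℝ)) c).indicator (fun x ↦ Poly.eval (gp i) x) (y - L1) -
          (Icc (-(c : ℝ)) c).indicator (fun x ↦ Poly.eval (gp i) x) (y + L1)) +
        w2 * (2 * Poly.eval (gp i) y - (Icc (-(c : ℝ)) c).indicator (fun x ↦ Poly.eval (gp i) x) (y - L2) -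
          (Icc (-(c : ℝ)) c).indicator (fun x ↦ Poly.eval (gp i) x) (y + L2)) +
        w3 * (2 * Poly.eval (gp i) y - (Icc (-(c : ℝ)) c).indicator (fun x ↦ Poly.eval (gp i) x) (y - L3) -
          (Icc (-(c : ℝ)) c).indicator (fun x ↦ Poly.eval (gp i) x) (y + L3)) +
        w4 * (2 * Poly.eval (gp i) y - (Icc (-(c : ℝ)) c).indicator (fun x ↦ Poly.eval (gp i) x) (y - L4) -
          (Icc (-(c : ℝ)) c).indicator (fun x ↦ Poly.eval (gp i) x) (y + L4)))
    (hprimes' : ∀ y : ℝ, ∑ n ∈ weilPrimeIndex (c : ℝ), ((ArithmeticFunction.vonMangoldt n : ℝ) / Real.sqrt n) *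
        (2 * Poly.eval (gp i') y - (Icc (-(c : ℝ)) c).indicator (fun x ↦ Poly.eval (gp i') x) (y - Real.log n) -
          (Icc (-(c : ℝ)) c).indicator (fun x ↦ Poly.eval (gp i') x) (y + Real.log n)) =
      w1 * (2 * Poly.eval (gp i') y - (Icc (-(c : ℝ)) c).indicator (fun x ↦ Poly.eval (gp i') x) (y - L1) -
          (Icc (-(c : ℝ)) c).indicator (fun x ↦ Poly.eval (gp i') x) (y + L1)) +
        w2 * (2 * Poly.eval (gp i') y - (Icc (-(c : ℝ)) c).indicator (fun x ↦ Poly.eval (gp i') x) (y - L2) -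
          (Icc (-(c : ℝ)) c).indicator (fun x ↦ Poly.eval (gp i') x) (y + L2)) +
        w3 * (2 * Poly.eval (gp i') y - (Icc (-(c : ℝ)) c).indicator (fun x ↦ Poly.eval (gp i') x) (y - L3) -
          (Icc (-(c : ℝ)) c).indicator (fun x ↦ Poly.eval (gp i') x) (y + L3)) +
        w4 * (2 * Poly.eval (gp i') y - (Icc (-(c : ℝ)) c).indicator (fun x ↦ Poly.eval (gp i') x) (y - L4) -
          (Icc (-(c : ℝ)) c).indicator (fun x ↦ Poly.eval (gp i') x) (y + L4)))
    {m : ℕ} (hm : 0 < m) (lo hi : ℕ → ℚ)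
    (hq : ∀ j, j < m →
      IntervalIntegrable (fun ρ ↦ dt_windowResidual4 (c : ℝ) gp w1 L1 w2 L2 w3 L3 w4 L4 (Mt : ℝ) (fun a l ↦ (Wt a l : ℝ)) i
        (((PolyMP.panelCentre (c / (2 * m)) j : ℚ) : ℝ) + ρ) ^ 2) volume (-((c / (2 * m) : ℚ) : ℝ)) ((c / (2 * m) : ℚ) : ℝ) →
      IntervalIntegrable (fun ρ ↦ dt_windowResidual4 (c : ℝ) gp w1 L1 w2 L2 w3 L3 w4 L4 (Mt : ℝ) (fun a l ↦ (Wt a l : ℝ)) i'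
        (((PolyMP.panelCentre (c / (2 * m)) j : ℚ) : ℝ) + ρ) ^ 2) volume (-((c / (2 * m) : ℚ) : ℝ)) ((c / (2 * m) : ℚ) : ℝ) →
      IntervalIntegrable (fun ρ ↦
        dt_windowResidual4 (c : ℝ) gp w1 L1 w2 L2 w3 L3 w4 L4 (Mt : ℝ) (fun a l ↦ (Wt a l : ℝ)) i
        (((PolyMP.panelCentre (c / (2 * m)) j : ℚ) : ℝ) + ρ) *
        dt_windowResidual4 (c : ℝ) gp w1 L1 w2 L2 w3 L3 w4 L4 (Mt : ℝ) (fun a l ↦ (Wt a l : ℝ)) i'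
        (((PolyMP.panelCentre (c / (2 * m)) j : ℚ) : ℝ) + ρ)) volume (-((c / (2 * m) : ℚ) : ℝ)) ((c / (2 * m) : ℚ) : ℝ) →
      ((lo j : ℚ) : ℝ) ≤ ∫ ρ in (-((c / (2 * m) : ℚ) : ℝ))..((c / (2 * m) : ℚ) : ℝ),
          dt_windowResidual4 (c : ℝ) gp w1 L1 w2 L2 w3 L3 w4 L4 (Mt : ℝ) (fun a l ↦ (Wt a l : ℝ)) i
        (((PolyMP.panelCentre (c / (2 * m)) j : ℚ) : ℝ) + ρ) *
          dt_windowResidual4 (c : ℝ) gp w1 L1 w2 L2 w3 L3 w4 L4 (Mt : ℝ) (fun a l ↦ (Wt a l : ℝ)) i'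
        (((PolyMP.panelCentre (c / (2 * m)) j : ℚ) : ℝ) + ρ) ∧
      ∫ ρ in (-((c / (2 * m) : ℚ) : ℝ))..((c / (2 * m) : ℚ) : ℝ),
          dt_windowResidual4 (c : ℝ) gp w1 L1 w2 L2 w3 L3 w4 L4 (Mt : ℝ) (fun a l ↦ (Wt a l : ℝ)) i
        (((PolyMP.panelCentre (c / (2 * m)) j : ℚ) : ℝ) + ρ) *
          dt_windowResidual4 (c : ℝ) gp w1 L1 w2 L2 w3 L3 w4 L4 (Mt : ℝ) (fun a l ↦ (Wt a l : ℝ)) i'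
        (((PolyMP.panelCentre (c / (2 * m)) j : ℚ) : ℝ) + ρ) ≤ ((hi j : ℚ) : ℝ)) :
    2 * ∑ j ∈ Finset.range m, ((lo j : ℚ) : ℝ) ≤
      (∫ y, (F i - ∑ l, ((Wt i l : ℝ) + if l = i then (Mt : ℝ) - weilMarkovConstant (c : ℝ) else 0) • v l) y *
        conj ((F i' - ∑ l, ((Wt i' l : ℝ) + if l = i' then (Mt : ℝ) - weilMarkovConstant (c : ℝ) else 0) • v l) y)).re ∧
    (∫ y, (F i - ∑ l, ((Wt i l : ℝ) + if l = i then (Mt : ℝ) - weilMarkovConstant (c : ℝ) else 0) • v l) y *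
        conj ((F i' - ∑ l, ((Wt i' l : ℝ) + if l = i' then (Mt : ℝ) - weilMarkovConstant (c : ℝ) else 0) • v l) y)).re ≤
      2 * ∑ j ∈ Finset.range m, ((hi j : ℚ) : ℝ) := by
  have hc' : (0 : ℝ) < c := by exact_mod_cast hc
  refine dt_residual_cross_mem_of_panels hc' hσ (fun l x ↦ Poly.eval (gp l) x) (fun l ↦ dt_contDiff_polyEval (gp l)) hgp v F hv hF
    (fun i l ↦ (Wt i l : ℝ) + if l = i then (Mt : ℝ) - weilMarkovConstant (c : ℝ) else 0) i i' hm _ _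
    (fun _ hy ↦ dt_residual_eq_windowResidual4 hc' hv hF (Mt : ℝ) (fun a l ↦ (Wt a l : ℝ)) i hprimes hy)
    (fun _ hy ↦ dt_residual_eq_windowResidual4 hc' hv hF (Mt : ℝ) (fun a l ↦ (Wt a l : ℝ)) i' hprimes' hy)
    (fun j ↦ ((lo j : ℚ) : ℝ)) (fun j ↦ ((hi j : ℚ) : ℝ)) (fun j hj ↦ ?_) (fun j hj ↦ ?_)
  all_goals
    have e1 : (2 * (j : ℝ) + 1) * ((c : ℝ) / (2 * m)) = ((PolyMP.panelCentre (c / (2 * m)) j : ℚ) : ℝ) :=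
      (dt_panelCentre_castL c m j).symm
    have e2 : (c : ℝ) / (2 * m) = ((c / (2 * m) : ℚ) : ℝ) := (dt_halfWidth_cast c m).symm
    have hR1 := dt_windowResidual4_sq_intervalIntegrable hc' hv hF (Mt : ℝ) (fun a l ↦ (Wt a l : ℝ)) i hprimes hm hj
    have hR2 := dt_windowResidual4_sq_intervalIntegrable hc' hv hF (Mt : ℝ) (fun a l ↦ (Wt a l : ℝ)) i' hprimes' hm hj
    have hR3 := dt_windowResidual4_mul_intervalIntegrableL hc hv hF Mt Wt i i' hprimes hprimes' hm hj
    rw [e1, e2] at hR1 hR2 ⊢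
  · exact (hq j hj hR1 hR2 hR3).1
  · exact (hq j hj hR1 hR2 hR3).2

end CrossAssembly4

end Summit.RiemannHypothesis.RiemannHypothesis.Theorems.EvenWinsBeyondArch

end
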